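import Mathlib
import Summits.ResolutionOfSingularities.ResolutionOfSingularities.Theorems.RadicialJungCleanModelsL7bGlobalCleanSeq
import Literature.AlgebraicGeometry.Resolution.ComponentGluing
import Literature.AlgebraicGeometry.Resolution.BlowupSequences
import HarnessLib

/-!
# Route `RadicialJung`, crux `CleanModels` (stmt-ResolutionOfSingularities-15917), line `Sketch` rev 35, stub 6 `stub_cleanProp44` (X44c),
# the CURVE-CENTRE STEP of X_perm: make a regular curve of the non-principal locus clean-permissible (L7b-global), then blow it up —
# the composite is again a clean-permissible Cossart–Piltant sequence

Memo `Cruxes/CleanModels/Lines/Sketch-memo-hand2-g10-stubs-5-7.md` §4 (i); memo 4e §2 «X_perm: L7b + cons».  On a stage `ρ : X → S` of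
`stub_cleanProp44` (`IsCleanRegularCentreBlowupSeq p ρ J G₀`, `S` regular excellent Noetherian, the line of `G₀` clean-regular everywhere, `X` Noetherian),
a one-dimensional regular curve `C₀ = cl{η} ⊆ X` (`dim 𝒪_η = 2`; other points closed with `dim 3`) lying in the non-locally-principal locus of `J𝒪_X` is
first made clean-permissible by `σ : X' → X` (✓ `exists_isCleanRegularCentreBlowupSeq_forall_cleanPermissibleAt_of_stage`) and then its strict transform
`C = cl{η'}` is blown up, `τ : X'' → X'`; the composite `τ ≫ σ ≫ ρ` is AGAIN a clean-permissible Cossart–Piltant sequence for `(J, G₀)`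
(`exists_isCleanRegularCentreBlowupSeq_blowup_strictTransform_of_stage`; ✓ `IsCleanRegularCentreBlowupSeq.cons` with the regular-curve data:
✓ `ComponentGluing.isIntegral_subscheme_vanishingIdeal`, ✓ `isRegular_subscheme_vanishingIdeal_of_forall_isRsopPart`).

Honest framing: OURS; this is the insertion procedure «point blow-ups, then the curve» of [CJS 2020, Thm. 6.28 Step 5] / [CoP1, Prop. 4.4] typed for the
CLEAN-PERMISSIBLE predicate of X44c — the termination bookkeeping of X44c (O6: what these insertions do to `ord J` and the Hilbert–Samuel strata,
O1–O5, O7) is untouched; nothing here proves X44c, resolution in characteristic `p`, or any case of `CleanModels`.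
-/

noncomputable section

set_option linter.dupNamespace false -- mandated namespace of this single-conjunct summit

open CategoryTheory AlgebraicGeometry TopologicalSpace IsLocalRing Opposite
open Literature.AlgebraicGeometry.Resolution Literature.AlgebraicGeometry.Motives
open Scheme.IdealSheafData

namespace Summit.ResolutionOfSingularities.ResolutionOfSingularities.Theorems.RadicialJung.CleanModels

/-- **The curve-centre step of X_perm in X44c's predicate.**  See the module docstring. [cite: CossartPiltant2019, Prop. 4.4 (i)]
[cite: CossartJannsenSaito2020, proof of Thm. 6.28, Step 5] [cite: CossartPiltant2008, Prop. 4.4 (proof, p. 10)] [cite: Piltant2013, §2 Axiom 4] -/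
theorem exists_isCleanRegularCentreBlowupSeq_blowup_strictTransform_of_stage (p : ℕ) [hp : Fact p.Prime] {S : Scheme.{0}}
    [IsIntegral S] [IsNoetherian S] [CharP S.functionField p] (hS : Scheme.IsRegular S) (hE : Scheme.IsExcellent S) (G₀ : S.functionField)
    (hG₀ : ∀ s : S, CleanRegAt p (algebraMap (S.presheaf.stalk s) S.functionField) G₀) {J : S.IdealSheafData}
    {X : Scheme.{0}} {ρ : X ⟶ S} [IsIntegral X] [IsNoetherian X] [IsDominant ρ] (hρ : IsCleanRegularCentreBlowupSeq p ρ J G₀)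
    {C₀ : Closeds X}
    (hC₀reg : ∀ y ∈ (C₀ : Set X), ∃ c : Fin 2 → X.presheaf.stalk y,
      IsRsopPart c ∧ Ideal.span (Set.range c) = stalkIdeal (vanishingIdeal C₀) y)
    {η : X} (hη : (C₀ : Set X) = closure {η}) (hdimη : ringKrullDim (X.presheaf.stalk η) = 2)
    (hcl : ∀ y ∈ (C₀ : Set X), y ≠ η → IsClosed ({y} : Set X)) (hdim3 : ∀ y ∈ (C₀ : Set X), y ≠ η → ringKrullDim (X.presheaf.stalk y) = 3)
    (hnp : ∀ y ∈ (C₀ : Set X), ¬ IsLocallyPrincipalAt (J.comap ρ) y) :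
    ∃ (X' : Scheme.{0}) (_ : IsIntegral X') (_ : IsNoetherian X') (σ : X' ⟶ X) (_ : IsDominant σ) (C : Closeds X') (η' : X')
      (X'' : Scheme.{0}) (_ : IsIntegral X'') (_ : IsNoetherian X'') (τ : X'' ⟶ X') (_ : IsDominant τ),
      (C : Set X') = closure {η'} ∧ σ η' = η ∧
      (∀ y ∈ (C : Set X'), ∃ c : Fin 2 → X'.presheaf.stalk y, IsRsopPart c ∧ Ideal.span (Set.range c) = stalkIdeal (vanishingIdeal C) y) ∧
      (∀ y ∈ (C : Set X'), CleanPermissibleAt p (RatFn.toFunctionField y) (RatFn.functionFieldMap (σ ≫ ρ) G₀) (stalkIdeal (vanishingIdeal C) y)) ∧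
      IsBlowup τ (vanishingIdeal C) ∧ IsCleanRegularCentreBlowupSeq p (σ ≫ ρ) J G₀ ∧
      IsCleanRegularCentreBlowupSeq p (τ ≫ σ ≫ ρ) J G₀ := by
  obtain ⟨X', hX'i, hX'n, σ, hσd, C, η', hseq, hprop, hX', hE', hCreg, hη', hση', hnp', hall⟩ :=
    exists_isCleanRegularCentreBlowupSeq_forall_cleanPermissibleAt_of_stage p hS hE G₀ hG₀ hρ hC₀reg hη hdimη hcl hdim3 hnp
  haveI := hX'i
  haveI := hX'n
  haveI := hσd
  -- the centre `C` is a nonzero ideal, integral and regular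
  have hη'C : η' ∈ (C : Set X') := by rw [hη']; exact subset_closure rfl
  have hYbot : vanishingIdeal C ≠ ⊥ := by
    intro hbot
    obtain ⟨c, hc, hspan⟩ := hCreg η' hη'C
    haveI := hc.1
    have hc0 : c 0 ∈ stalkIdeal (vanishingIdeal C) η' := hspan ▸ Ideal.subset_span ⟨0, rfl⟩
    rw [hbot, stalkIdeal_bot, Ideal.mem_bot] at hc0
    exact hc.ne_zero 0 hc0
  have hint : IsIntegral (vanishingIdeal C).subscheme :=
    ComponentGluing.isIntegral_subscheme_vanishingIdeal C (by rw [hη']; exact isIrreducible_singleton.closure)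
  have hreg : Scheme.IsRegular (vanishingIdeal C).subscheme :=
    isRegular_subscheme_vanishingIdeal_of_forall_isRsopPart fun x hx => by
      obtain ⟨c, hc, h⟩ := hCreg x hx
      exact ⟨2, c, hc, h⟩
  -- blow it up
  set τ := blowup.π (vanishingIdeal C) with hτdef
  have hτ : IsBlowup τ (vanishingIdeal C) := blowup.isBlowup _
  haveI : IsIntegral (blowup (vanishingIdeal C)) := hτ.isIntegral hYbot
  haveI : IsDominant τ := isDominant_of_isBlowup_of_ne_bot hτ hYbot
  haveI : IsProper τ := hτ.isProper
  haveI : CompactSpace (blowup (vanishingIdeal C)) := QuasiCompact.compactSpace_of_compactSpace τ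
  haveI : IsLocallyNoetherian (blowup (vanishingIdeal C)) := LocallyOfFiniteType.isLocallyNoetherian τ
  haveI : IsNoetherian (blowup (vanishingIdeal C)) := {}
  have hcons : IsCleanRegularCentreBlowupSeq p (τ ≫ σ ≫ ρ) J G₀ :=
    IsCleanRegularCentreBlowupSeq.cons τ (σ ≫ ρ) J G₀ C hseq hint hreg hnp' hτ (fun y hy => hall y hy)
  exact ⟨X', hX'i, hX'n, σ, hσd, C, η', blowup (vanishingIdeal C), inferInstance, inferInstance, τ, inferInstance, hη', hση', hCreg, hall, hτ,
    hseq, hcons⟩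

end Summit.ResolutionOfSingularities.ResolutionOfSingularities.Theorems.RadicialJung.CleanModels

end
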